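/-
Copyright: statement-level skeleton of a published paper (lit-balaban cell, Phase-2 proof seat p25, gen 15). No proof
claims beyond what the kernel checks below.
-/
import Literature.MathematicalPhysics.QuantumFieldTheory.BalabanImbrieJaffe1984to88.BIJ88VertexExpansion311

/-!
# `BalabanImbrieJaffe1984to88.BIJ88VertexRemainder312` — T. Bałaban, J. Imbrie, A. Jaffe, *Effective action and cluster
properties of the abelian Higgs model*, Commun. Math. Phys. **114** (1988) 257–315 [BalabanImbrieJaffe1988], §5.14
p. 311–312 [PDF 55–56] *"The components containing contractions to χ′_{Λ^{(k)}}, terms from the random walk expansions, or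
at least m̄+1 interactions are called remainder components {X_r}. … The main source of concern in estimating G_k(X_{r′})
is that we only have bounds |F^{m̄}_{k,loc}(X_{σ_i})| ≤ c(L^kε)^{−m(c)}e^{−m′(c)} … By performing sufficiently many
integrations by parts, we have arranged for enough small factors to beat these large factors in the remainder terms"* —
**THE REMAINDER OF THE VERTEX EXPANSION SPLIT BY ITS SMALL FACTOR**: the remainder part `remv` of p25 gen 15's
`BIJ88VertexExpansion311` (one component) is the sum of the `cap` terms (*"at least m̄+1 interactions"* — each carrying
the coupling-constant factor `c_M^{m̄+1}` by `coef_bound`/`terms_sound`) and of the `χ′`-terms (*"contractions to χ′"* —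
each carrying a factor `∂_zχ` under the integral, small by its support in the model; left displayed), with the
corresponding bound: `|Σ_cap| ≤ (max B 1)^{|L|+1+m̄D}·c_M^{m̄+1}·Σ_cap |∫Π_{pend}Φ·χe^{−V}dμ|`.

statement-level skeleton of published theorems with citation tags; proofs where landed; nothing here is a claim
about the Yang–Mills mass gap

PDF held: `paper:balaban1988-cmp114-bij-abelian-higgs-effective-action` (journal page = PDF page + 256); p. 311–312 = PDF
55–56.

CITATION HEADER (lean-in-tree rule).  lit-balaban cell (HOME `run/shared/lean/pub/lit-balaban/`), Phase 2, seat p25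
gen 15; row **C2.Claim@312** of `HOME/lit-balaban-r16/ROWS-C2-part2.md` (owner r16, referee ref-5; head untouched —
toward the owner's flip-path item (γ) *"each remainder component carries one of the three small factors"*: here the
vertex factor is made quantitative for one component; the `χ′` factor stays displayed; the random-walk factor does not
occur with one covariance).  USED BY NAME, nothing restated: `BIJ88VertexIbp311.{lmono, vexp}`,
`BIJ88VertexExpansion311.{terms, Kind, kfac, tint, remv, terms_sound, coef_bound}`.

## What is proved (0 `sorry`, standard axioms, no new `Prop` facts, theorems only)
* `remv_eq_cap_add_dchi` — `Σ_rem = Σ_cap + Σ_χ′`;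
* `abs_sum_cap_le` — THE VERTEX SMALL FACTOR: `|Σ_cap| ≤ (max B 1)^{|L|+1+bD} · c_M^{b+1} · Σ_cap |∫Π_{pend t}Φ·χe^{−V}dμ|`;
* `abs_sum_dchi_le` — `|Σ_χ′| ≤ (max B 1)^{|L|+1+bD} · Σ_χ′ c_M^{nv t}|∫Π_{pend t}Φ·(∂_zχ)e^{−V}dμ|` (the integrals carry
  `∂_zχ`);
* `abs_remv_le` — both together.
HONEST SCOPE: the sums over terms count histories with multiplicity (print's combinatorial factors live inside
`Σ|∫…|`); no bound on the integrals themselves (Gaussian moments against `χe^{−V}` / `(∂χ)e^{−V}` — model estimates,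
p36's shell bounds for the `χ′` support); one component, one covariance.  NOT summit progress; NOT continuum; NOT Clay.
Imports `BIJ88VertexExpansion311` only; modifies nothing.
-/

noncomputable section

namespace Literature.MathematicalPhysics.QuantumFieldTheory.BalabanImbrieJaffe1984to88.BIJ88VertexRemainder312

open MeasureTheory Matrix Finset
open scoped BigOperators
open Literature.MathematicalPhysics.QuantumFieldTheory.Balaban1983to89
open B2Eq228Conditioning (weight source)
open BIJ88VertexIbp311 (lmono vexp)
open BIJ88VertexExpansion311 (Kind Term terms kfac tint remv terms_sound coef_bound)

variable {S : Type} [Fintype S] [DecidableEq S] {ι : Type} [Fintype ι]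

omit [Fintype S] [DecidableEq S] [Fintype ι] in
/-- `|Σ_l g| ≤ Σ_l |g|` for list sums. [folklore] -/
private theorem abs_sum_map_le {β : Type} (l : List β) (g : β → ℝ) : |(l.map g).sum| ≤ (l.map fun x => |g x|).sum := by
  induction l with
  | nil => simp
  | cons x l ih =>
    simp only [List.map_cons, List.sum_cons]
    exact (abs_add_le _ _).trans (by linarith)

variable (A : Matrix S S ℝ) (f : S → ℝ) (χ : (S → ℝ) → ℝ) (c : ι → ℝ) (legs : ι → List (S → ℝ))

omit [DecidableEq S] in
/-- The Gaussian integral a term carries (its value is `coef` times this). [cite: BalabanImbrieJaffe1988, §5.14 p.312] -/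
theorem tint_eq (t : Term S) : tint A f χ c legs t
    = t.coef * ∫ φ : S → ℝ, lmono t.pend φ * (kfac χ t.kind φ * vexp c legs φ) * (weight A φ * source f φ) := rfl

/-- **The remainder splits by the reason of completeness**: `Σ_rem = Σ_cap + Σ_χ′` (*"at least m̄+1 interactions"* /
*"contractions to χ′"*; the random-walk kind does not occur with one covariance). [cite: BalabanImbrieJaffe1988, §5.14 p.311–312] -/
theorem remv_eq_cap_add_dchi (L : List (S → ℝ)) (b : ℕ) :
    remv A f χ c legs L b
      = ((terms A f c legs L b).map fun t => match t.kind with | .cap => tint A f χ c legs t | _ => 0).sum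
        + ((terms A f c legs L b).map fun t => match t.kind with | .dchi _ => tint A f χ c legs t | _ => 0).sum := by
  rw [remv, ← List.sum_map_add]
  congr 1
  refine List.map_congr_left fun t _ => ?_
  rcases t.kind with _ | z | _ <;> simp

variable {A f c legs}

/-- **THE VERTEX SMALL FACTOR OF THE `cap` TERMS** — *"at least m̄+1 interactions have been differentiated down … enough
small factors to beat these large factors"*: with covariance brackets bounded by `B` on a direction set containing the
legs and the vertex legs, `0 ≤ c_M`, `|c_m| ≤ c_M`, vertex arities `≤ D`,
`|Σ_cap| ≤ (max B 1)^{|L|+1+bD} · c_M^{b+1} · Σ_cap |∫ Π_{pend t}Φ · χe^{−V} dμ|`. [cite: BalabanImbrieJaffe1988, §5.14 p.312] -/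
theorem abs_sum_cap_le {Dir : Set (S → ℝ)} {B cM : ℝ} (hB : ∀ u ∈ Dir, ∀ v ∈ Dir, |(A⁻¹ *ᵥ u) ⬝ᵥ v| ≤ B)
    (hBf : ∀ u ∈ Dir, |(A⁻¹ *ᵥ u) ⬝ᵥ f| ≤ B) (hcM : 0 ≤ cM) (hc : ∀ m, |c m| ≤ cM)
    (hlegs : ∀ m, ∀ w ∈ legs m, w ∈ Dir) {D : ℕ} (hD : ∀ m, (legs m).length ≤ D) {L : List (S → ℝ)}
    (hL : ∀ w ∈ L, w ∈ Dir) (b : ℕ) :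
    |((terms A f c legs L b).map fun t => match t.kind with | .cap => tint A f χ c legs t | _ => 0).sum|
      ≤ (max B 1) ^ (L.length + 1 + b * D) * cM ^ (b + 1) *
          ((terms A f c legs L b).map fun t => match t.kind with
            | .cap => |∫ φ : S → ℝ, lmono t.pend φ * (χ φ * vexp c legs φ) * (weight A φ * source f φ)|
            | _ => 0).sum := by
  rw [← List.sum_map_mul_left]
  refine (abs_sum_map_le _ _).trans (List.sum_le_sum fun t ht => ?_)
  obtain ⟨-, hcap, -⟩ := terms_sound A f c legs L b t ht
  have hcoef := coef_bound A f c legs hB hBf hcM hc hlegs hD L b hL t ht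
  rcases hk : t.kind with _ | z | _
  · simp
  · simp
  · simp only [tint_eq, hk, BIJ88VertexExpansion311.kfac_cap, abs_mul]
    rw [hcap hk] at hcoef
    exact mul_le_mul_of_nonneg_right hcoef (abs_nonneg _)

/-- **The `χ′`-terms**: `|Σ_χ′| ≤ (max B 1)^{|L|+1+bD} · Σ_χ′ c_M^{nv t}·|∫ Π_{pend t}Φ · (∂_zχ)e^{−V} dμ|` — their small
factor is the `∂_zχ` under the integral (support of `χ′`), not extracted here. [cite: BalabanImbrieJaffe1988, §5.14 p.312] -/
theorem abs_sum_dchi_le {Dir : Set (S → ℝ)} {B cM : ℝ} (hB : ∀ u ∈ Dir, ∀ v ∈ Dir, |(A⁻¹ *ᵥ u) ⬝ᵥ v| ≤ B)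
    (hBf : ∀ u ∈ Dir, |(A⁻¹ *ᵥ u) ⬝ᵥ f| ≤ B) (hcM : 0 ≤ cM) (hc : ∀ m, |c m| ≤ cM)
    (hlegs : ∀ m, ∀ w ∈ legs m, w ∈ Dir) {D : ℕ} (hD : ∀ m, (legs m).length ≤ D) {L : List (S → ℝ)}
    (hL : ∀ w ∈ L, w ∈ Dir) (b : ℕ) :
    |((terms A f c legs L b).map fun t => match t.kind with | .dchi _ => tint A f χ c legs t | _ => 0).sum|
      ≤ (max B 1) ^ (L.length + 1 + b * D) *
          ((terms A f c legs L b).map fun t => match t.kind with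
            | .dchi z => cM ^ t.nv *
                |∫ φ : S → ℝ, lmono t.pend φ * (fderiv ℝ χ φ z * vexp c legs φ) * (weight A φ * source f φ)|
            | _ => 0).sum := by
  rw [← List.sum_map_mul_left]
  refine (abs_sum_map_le _ _).trans (List.sum_le_sum fun t ht => ?_)
  have hcoef := coef_bound A f c legs hB hBf hcM hc hlegs hD L b hL t ht
  rcases hk : t.kind with _ | z | _
  · simp
  · simp only [tint_eq, hk, BIJ88VertexExpansion311.kfac_dchi, abs_mul, ← mul_assoc]
    exact mul_le_mul_of_nonneg_right hcoef (abs_nonneg _)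
  · simp

/-- **THE REMAINDER BOUND BY SMALL FACTORS** (one component): `|Σ_rem| ≤ (max B 1)^{|L|+1+bD}·(c_M^{b+1}·Σ_cap|∫…| +
Σ_χ′ c_M^{nv}|∫…(∂_zχ)…|)`. [cite: BalabanImbrieJaffe1988, §5.14 p.312] -/
theorem abs_remv_le {Dir : Set (S → ℝ)} {B cM : ℝ} (hB : ∀ u ∈ Dir, ∀ v ∈ Dir, |(A⁻¹ *ᵥ u) ⬝ᵥ v| ≤ B)
    (hBf : ∀ u ∈ Dir, |(A⁻¹ *ᵥ u) ⬝ᵥ f| ≤ B) (hcM : 0 ≤ cM) (hc : ∀ m, |c m| ≤ cM)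
    (hlegs : ∀ m, ∀ w ∈ legs m, w ∈ Dir) {D : ℕ} (hD : ∀ m, (legs m).length ≤ D) {L : List (S → ℝ)}
    (hL : ∀ w ∈ L, w ∈ Dir) (b : ℕ) :
    |remv A f χ c legs L b|
      ≤ (max B 1) ^ (L.length + 1 + b * D) *
          (cM ^ (b + 1) * ((terms A f c legs L b).map fun t => match t.kind with
              | .cap => |∫ φ : S → ℝ, lmono t.pend φ * (χ φ * vexp c legs φ) * (weight A φ * source f φ)|
              | _ => 0).sum
            + ((terms A f c legs L b).map fun t => match t.kind with
              | .dchi z => cM ^ t.nv *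
                  |∫ φ : S → ℝ, lmono t.pend φ * (fderiv ℝ χ φ z * vexp c legs φ) * (weight A φ * source f φ)|
              | _ => 0).sum) := by
  rw [remv_eq_cap_add_dchi, mul_add, ← mul_assoc]
  exact (abs_add_le _ _).trans (add_le_add (abs_sum_cap_le χ hB hBf hcM hc hlegs hD hL b)
    (abs_sum_dchi_le χ hB hBf hcM hc hlegs hD hL b))

end Literature.MathematicalPhysics.QuantumFieldTheory.BalabanImbrieJaffe1984to88.BIJ88VertexRemainder312
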